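import Summits.BirchSwinnertonDyer.Rank1Residual.X11b.Three.TamagawaAtomShapes
import Summits.BirchSwinnertonDyer.Rank1Residual.X11b.MultiplicativeSurjectivity
import Summits.BirchSwinnertonDyer.Rank1Residual.X2.TwistKodaira
import Literature.NumberTheory.EllipticCurves.NeronComponentIndexTypeIVProofs
import Literature.NumberTheory.EllipticCurves.NeronComponentIndexTypeIVstarProofs
import Literature.NumberTheory.DiophantineGeometry.TateAlgorithmOrdDiscriminant
import Literature.NumberTheory.DiophantineGeometry.TateAlgorithmAdditiveProofs
import Literature.NumberTheory.DiophantineGeometry.MinimalDiscriminantNormProofs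
import Literature.NumberTheory.EllipticCurves.BSDConductorProofs
import HarnessLib

/-!
# Class X11b at `p = 3`, the non-surjective CORNER (T4″)@3: no (T2γ)-carrier away from `2`
# (team N8/O2 = cell `b2b-bsdres`, sub-target S14, seat x11b3-p6; consumers S12 `CornerResidual`
# (p8) and S13 `ClassRecordResidual` v4.1 (p3))

HONEST FRAMING (verbatim, cell `b2b-bsdres`, run/shared/lean/b2b/bsd-rank1-residual/): the goal of
the cell is to DELETE the COMBINATION-SHAPED residual classes for ALL analytic-rank `≤ 1` curves
over `ℚ` — "full BSD formula for every rank `≤ 1` curve in class `C`" assembled STRICTLY from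
published theorems — so that the rank-`≤ 1` remainder becomes exactly the CONSTRUCTION-SHAPED
classes, which are TYPED (missing-input Props), NOT attempted; this is not "finishing BSD".
Team N8/O2 (X11b at `3`: `3 ∥ N`, `r_an = 1`, `E[3]` irreducible; O2 OPEN). Research route; nothing
booked; NO label changes. THEOREMS ONLY (no definitions, no named facts); the one classical input
that is not in the tree — Serre's inertia order at a potentially good prime `ℓ ≥ 5` (Serre 1972
§5.6, quoted verbatim by Martin–Watkins 2006 §3.1–3.2) — enters as the EXPLICIT HYPOTHESIS `hF`,
spelled out at the pair (its named `Prop` form, `serre_inertiaOrder_dvd_card_range_galoisRepTorsion`,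
is filed separately under `Literature/NumberTheory/EllipticCurves/PotentiallyGoodInertiaOrder.lean`
and instantiates `hF`); no `sorry`.

## What this file proves

The (T4″)@3 corner of X11b@3 is `ClassX11b W 3 ∧ ¬ Surj W 3` (mod-`3` image `3Ns`/`3Nn`). The
Tamagawa atom's third shape `ShapeGamma W` ((T2γ)@3, `TamagawaAtomShapes`) asks for a place of
Kodaira type `IV` or `IV*` with local Tamagawa number `3`. CORNER CENSUS (x11b3-p6, kit j122802,
296 class-pairs, two engines): no corner curve has type `IV` or `IV*` at ANY prime, and at the
344 odd additive primes only `III, III*, I₀*, I₃*, I₆*` occur. This file turns the part of that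
observation AWAY FROM `2` into a theorem, class-wide:

* `Three.not_three_dvd_card_range_galoisRepTorsion_of_not_surj` — on the corner,
  `3 ∤ #ρ̄_{E,3}(Γ_ℚ)` (tree: Serre 1972 Prop. 15 via `not_dvd_card_of_not_hasSurjectiveModNGaloisRep`).
* `WeierstrassCurve.valuation_j_le_one_of_kodairaSymbolAt_IV_or_IVstar` — at a finite place of
  residue characteristic `≠ 2, 3`, Kodaira type `IV` or `IV*` forces `j` to be `v`-integral
  (POTENTIALLY GOOD reduction): Tate's normal forms (`a₁, a₂, a₃ ∈ 𝔪, a₄, a₆ ∈ 𝔪²`, resp.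
  `a₁ ∈ 𝔪, a₂, a₃ ∈ 𝔪², a₄ ∈ 𝔪³, a₆ ∈ 𝔪⁴`) give `c₄ ∈ 𝔪²`, resp. `𝔪³`, while
  `ord_v Δ_min = m_v + 1 = 4`, resp. `8` (`ordMinimalDiscriminant_eq_numComponentsAt_add_one_holds`),
  so `ord_v(j) = 3 ord_v(c₄) − ord_v(Δ) ≥ 6 − 4`, resp. `9 − 8`. (Any Dedekind domain; no fact.)
* the hypothesis `hF` (THE ONE CITED INPUT, Serre 1972 §5.6 as quoted by Martin–Watkins 2006
  §3.2: "when `p ≥ 5` … the inertia group is `Φ = C_d` where `d = 12/gcd(12, v_p(Δ_E))`", for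
  good or potentially good reduction, i.e. `j` `p`-integral), in the weakest per-curve form used:
  for every place `v ∣ ℓ ≥ 5` at which `j(E)` is integral, `12 / gcd(12, ord_v Δ_min)` divides
  `#ρ̄_{E,3}(Γ_ℚ)` (the inertia subgroup of `Gal(ℚ_ℓ(E[3])/ℚ_ℓ)` embeds in `Gal(ℚ(E[3])/ℚ)`).
* `Three.primesEquiv_eq_two_of_not_surj_of_kodairaSymbolAt_IV_or_IVstar` — **granted `hF`, on the
  corner every place of Kodaira type `IV` or `IV*` lies over `2`**: over `ℓ ≥ 5` the hypothesis
  gives `12 / gcd(12, 4) = 12 / gcd(12, 8) = 3 ∣ #ρ̄_{E,3}(Γ_ℚ)`, contradicting the first bullet;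
  `ℓ = 3` is multiplicative on X11b@3 (`primesEquiv_ne_three_of_typeIV`).
* `Three.shapeGamma_over_two_of_not_surj` — hence a (T2γ)@3 witness of a corner curve, if any,
  lies over `2`: on the corner the Tamagawa-sharp upper binder quantifies over carriers
  {α at `3`, β at split multiplicative `ℓ ≠ 3`, γ at `ℓ = 2` only} (for S12/S13).

Out of scope (census only): `ℓ = 2` (0 of the 140 corner classes additive at `2` have type
`IV`/`IV*`; a theorem there needs Kraus 1990 / the wild group `Φ₂`).

References: [MartinWatkins2006] P. Martin, M. Watkins, *Symmetric powers of elliptic curve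
L-functions*, ANTS VII, LNCS 4076 (2006) 377–392, §3.1–§3.2; [Serre1972] J.-P. Serre, Invent. Math.
15 (1972), §5.6 (p. 312) and §2.4 Prop. 15; [SilvermanATAEC1994] IV.9.4 Steps 5 and 8, Table 4.1.
-/

noncomputable section

open scoped Classical NumberField

open WeierstrassCurve NumberField IsDedekindDomain Literature.NumberTheory.EllipticCurves
  Rat.HeightOneSpectrum
  Literature.NumberTheory.DiophantineGeometry
  Literature.NumberTheory.DiophantineGeometry.TateAlgorithm
  Literature.NumberTheory.EllipticCurves.Rank1Residual
open IsDiscreteValuationRing hiding maximalIdeal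

/-! ### Kodaira `IV` / `IV*` is potentially good: `j` is integral (any Dedekind domain) -/

namespace WeierstrassCurve

section Local

variable {A : Type*} [CommRing A] [IsDedekindDomain A] {K : Type*} [Field K]
  [Algebra A K] [IsFractionRing A K] (v : HeightOneSpectrum A) (W : WeierstrassCurve K)

/-- Kodaira type `IV` or `IV*` is an ADDITIVE type. [folklore] -/
theorem isAdditive_of_eq_IV_or_IVstar {k : KodairaSymbol} (hk : k = .IV ∨ k = .IVstar) :
    k.IsAdditive := by
  refine ⟨fun hg => ?_, fun ⟨n, _, hn⟩ => ?_⟩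
  · rcases hk with hk | hk <;> rw [hk] at hg <;> exact KodairaSymbol.noConfusion hg
  · rcases hk with hk | hk <;> rw [hk] at hn <;> exact KodairaSymbol.noConfusion hn

/-- **Tate's normal form of type `IV` puts `c₄` in `𝔪²`.** For an `R`-model `J` with
`a₁, a₂, a₃ ∈ I` and `a₄ ∈ I²`: `b₂ = a₁² + 4a₂ ∈ I`, `b₄ = 2a₄ + a₁a₃ ∈ I²`, so
`c₄ = b₂² − 24 b₄ ∈ I²`. [cite: SilvermanATAEC1994, IV.9.4 Step 5 (PDF pp. 344–345) and III.1 (b₂, b₄, c₄)] -/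
theorem c₄_mem_sq_of_normalForm_IV {R : Type*} [CommRing R] (I : Ideal R) (J : WeierstrassCurve R)
    (h1 : J.a₁ ∈ I) (h2 : J.a₂ ∈ I) (h3 : J.a₃ ∈ I) (h4 : J.a₄ ∈ I ^ 2) : J.c₄ ∈ I ^ 2 := by
  have hb₂ : J.b₂ ∈ I := by
    rw [WeierstrassCurve.b₂, sq]
    exact I.add_mem (I.mul_mem_left _ h1) (I.mul_mem_left _ h2)
  have hb₄ : J.b₄ ∈ I ^ 2 := by
    rw [WeierstrassCurve.b₄]
    refine Ideal.add_mem _ (Ideal.mul_mem_left _ _ h4) ?_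
    rw [sq]
    exact Ideal.mul_mem_mul h1 h3
  rw [WeierstrassCurve.c₄]
  exact Ideal.sub_mem _ (Ideal.pow_mem_pow hb₂ 2) (Ideal.mul_mem_left _ _ hb₄)

/-- **Tate's normal form of type `IV*` puts `c₄` in `𝔪³`.** For an `R`-model `J` with `a₁ ∈ I`,
`a₂, a₃ ∈ I²`, `a₄ ∈ I³`: `b₂ ∈ I²`, `b₄ ∈ I³`, so `c₄ = b₂² − 24 b₄ ∈ I⁴ + I³ = I³`.
[cite: SilvermanATAEC1994, IV.9.4 Step 8 (PDF p. 346) and III.1 (b₂, b₄, c₄)] -/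
theorem c₄_mem_cube_of_normalForm_IVstar {R : Type*} [CommRing R] (I : Ideal R)
    (J : WeierstrassCurve R) (h1 : J.a₁ ∈ I) (h2 : J.a₂ ∈ I ^ 2) (h3 : J.a₃ ∈ I ^ 2)
    (h4 : J.a₄ ∈ I ^ 3) : J.c₄ ∈ I ^ 3 := by
  have hb₂ : J.b₂ ∈ I ^ 2 := by
    rw [WeierstrassCurve.b₂]
    exact Ideal.add_mem _ (Ideal.pow_mem_pow h1 2) (Ideal.mul_mem_left _ _ h2)
  have hb₄ : J.b₄ ∈ I ^ 3 := by
    rw [WeierstrassCurve.b₄]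
    refine Ideal.add_mem _ (Ideal.mul_mem_left _ _ h4) ?_
    show J.a₁ * J.a₃ ∈ I ^ (2 + 1)
    rw [pow_succ']
    exact Ideal.mul_mem_mul h1 h3
  have hb₂sq : J.b₂ ^ 2 ∈ I ^ 3 := by
    have h := Ideal.pow_mem_pow hb₂ 2
    rw [← pow_mul] at h
    exact Ideal.pow_le_pow_right (by norm_num) h
  rw [WeierstrassCurve.c₄]
  exact Ideal.sub_mem _ hb₂sq (Ideal.mul_mem_left _ _ hb₄)

/-- **Kodaira type `IV` or `IV*` at a place of residue characteristic `≠ 2, 3` forces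
`ord_v(j) ≥ 0`** (`v.valuation K W.j ≤ 1`; the reduction is POTENTIALLY GOOD): on the integral
local minimal model `M` over `O_v`, Tate's normal form (`exists_smul_of_kodairaSymbolOfMinimal_eq_IV`,
`…_IVstar`; perfect residue field) gives an `O_v`-isomorphic model `J = D • M` with `c₄(J) ∈ 𝔪²`,
resp. `𝔪³` (`c₄_mem_sq_of_normalForm_IV`, `c₄_mem_cube_of_normalForm_IVstar`), while `ord_v Δ(J) = ord_v Δ_min = m_v + 1 = 4`, resp. `8`
(`ordMinimalDiscriminant_eq_numComponentsAt_add_one_holds`, residue characteristic `≠ 2, 3`);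
since `j · Δ(J) = c₄(J)³` with `j = j(E)` an isomorphism invariant, `ord_v(j) ≥ 3·2 − 4`, resp.
`3·3 − 8`, both `≥ 0`. (Silverman *ATAEC* IV.9.4 Steps 5, 8 and Table 4.1: these types are
potentially good; cf. `one_lt_valuation_j_of_kodairaSymbolAt_eq_Istar_succ` for the opposite
behaviour of `Iₙ*`.) [cite: SilvermanATAEC1994, IV.9.4 Steps 5 and 8, Table 4.1 (PDF pp. 344–346, 365)] -/
theorem valuation_j_le_one_of_kodairaSymbolAt_IV_or_IVstar [W.IsElliptic]
    [PerfectField (IsLocalRing.ResidueField (v.adicCompletionIntegers K))]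
    (h2 : ringChar (A ⧸ v.asIdeal) ≠ 2) (h3 : ringChar (A ⧸ v.asIdeal) ≠ 3)
    (hT : W.kodairaSymbolAt v = .IV ∨ W.kodairaSymbolAt v = .IVstar) :
    v.valuation K W.j ≤ 1 := by
  set O := v.adicCompletionIntegers K with hO
  set M := W.localMinimalIntegralModel v with hM
  have hΔ0 : M.Δ ≠ 0 := localMinimalIntegralModel_Δ_ne_zero v W
  have hϖ : Irreducible (uniformizer O) := irreducible_uniformizer
  -- additive reduction and `ord_v Δ_min = m_v + 1 ∈ {4, 8}`
  have hadd : W.HasAdditiveReductionAt v :=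
    (W.isAdditive_kodairaSymbolAt_iff_holds v).mp (isAdditive_of_eq_IV_or_IVstar hT)
  have hord : W.ordMinimalDiscriminant v = W.numComponentsAt v + 1 :=
    W.ordMinimalDiscriminant_eq_numComponentsAt_add_one_holds v hadd h2 h3
  -- the exponent `k` with `c₄(J) ∈ 𝔪^k` and `d = ord_v Δ_min`, `d < 3k`
  obtain ⟨k, d, hk, hd, hdk, hnf⟩ : ∃ k d : ℕ, (k = 2 ∨ k = 3) ∧ W.ordMinimalDiscriminant v = d ∧
      d + 1 ≤ 3 * k ∧ ∃ D : VariableChange O,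
        (D • M).c₄ ∈ IsLocalRing.maximalIdeal O ^ k := by
    rw [kodairaSymbolAt_def] at hT
    rcases hT with hT | hT
    · obtain ⟨D, h1, h2', h3', h4, -, -⟩ := LocalIndex.exists_smul_of_kodairaSymbolOfMinimal_eq_IV M hT
      refine ⟨2, 4, Or.inl rfl, ?_, by norm_num, D, ?_⟩
      · rw [hord]; unfold numComponentsAt; rw [kodairaSymbolAt_def, ← hM, hT]; rfl
      · exact c₄_mem_sq_of_normalForm_IV _ _ h1 h2' h3' h4
    · obtain ⟨D, h1, h2', h3', h4, -, -⟩ := LocalIndex.exists_smul_of_kodairaSymbolOfMinimal_eq_IVstar M hT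
      refine ⟨3, 8, Or.inr rfl, ?_, by norm_num, D, ?_⟩
      · rw [hord]; unfold numComponentsAt; rw [kodairaSymbolAt_def, ← hM, hT]; rfl
      · exact c₄_mem_cube_of_normalForm_IVstar _ _ h1 h2' h3' h4
  obtain ⟨D, hc₄⟩ := hnf
  set J := D • M with hJ
  -- valuations on `K_v`: `Δ(M)`, the unit `D.u⁻¹`, the uniformiser, `c₄(J)`
  obtain ⟨N, hN, hvΔ⟩ := HeightOneSpectrum.exists_addVal_adicCompletionIntegers_eq K v M.Δ hΔ0
  have hNd : N = d := by
    have h1 : (IsDiscreteValuationRing.addVal O M.Δ).toNat = W.ordMinimalDiscriminant v := rfl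
    rw [hN, hd] at h1
    simpa using h1
  rw [hNd] at hvΔ
  have hvu : Valued.v (((D.u⁻¹ : Oˣ) : O) : v.adicCompletion K) = 1 :=
    HeightOneSpectrum.adicCompletionIntegers.isUnit_iff_valued_eq_one.mp (Units.isUnit _)
  obtain ⟨Nπ, hNπ, hvπ⟩ :=
    HeightOneSpectrum.exists_addVal_adicCompletionIntegers_eq K v (uniformizer O) hϖ.ne_zero
  have hNπ1 : Nπ = 1 := by
    have h1 : IsDiscreteValuationRing.addVal O (uniformizer O) = 1 := IsDiscreteValuationRing.addVal_uniformizer hϖ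
    rw [h1] at hNπ
    exact_mod_cast hNπ.symm
  rw [hNπ1] at hvπ
  have hvc₄ : Valued.v ((J.c₄ : O) : v.adicCompletion K) ≤ WithZero.exp (-(k : ℤ)) := by
    obtain ⟨t, ht⟩ := (mem_maximalIdeal_pow_iff_dvd_of_irreducible hϖ _ _).mp hc₄
    rw [ht]
    push_cast
    rw [map_mul, map_pow, hvπ, ← WithZero.exp_nsmul]
    have htle : Valued.v ((t : O) : v.adicCompletion K) ≤ 1 := t.2
    calc WithZero.exp ((k : ℕ) • (-1 : ℤ)) * Valued.v ((t : O) : v.adicCompletion K)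
        ≤ WithZero.exp ((k : ℕ) • (-1 : ℤ)) * 1 := by gcongr
      _ = WithZero.exp (-(k : ℤ)) := by rw [mul_one]; congr 1; simp
  -- `j · Δ(J) = c₄(J)³` in `K_v`, with `Δ(J) = u⁻¹² Δ(M)`
  have hjΔ : ∀ (E : WeierstrassCurve (v.adicCompletion K)) [E.IsElliptic],
      E.j * E.Δ = E.c₄ ^ 3 := fun E _ ↦ by
    rw [WeierstrassCurve.j, ← coe_Δ', mul_comm, ← mul_assoc, Units.mul_inv, one_mul]
  haveI hXell : (W.baseChange (v.adicCompletion K)).IsElliptic := by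
    unfold baseChange; infer_instance
  obtain ⟨C, hC⟩ : ∃ C : VariableChange (v.adicCompletion K),
      C • W.baseChange (v.adicCompletion K) = W.localMinimalModel v := ⟨_, rfl⟩
  have keyM : (W.j : v.adicCompletion K) * ((M.Δ : O) : v.adicCompletion K) =
      ((M.c₄ : O) : v.adicCompletion K) ^ 3 := by
    have hj' : (C • W.baseChange (v.adicCompletion K)).j = (W.j : v.adicCompletion K) := by
      rw [variableChange_j]; exact W.map_j _
    have hΔ' : ((M.Δ : O) : v.adicCompletion K) = (C • W.baseChange (v.adicCompletion K)).Δ := by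
      rw [hC, hM, localMinimalIntegralModel]
      exact integralModel_Δ_eq (v.adicCompletionIntegers K) (W.localMinimalModel v)
    have hc₄' : ((M.c₄ : O) : v.adicCompletion K) =
        (C • W.baseChange (v.adicCompletion K)).c₄ := by
      rw [hC, hM, localMinimalIntegralModel]
      exact integralModel_c₄_eq (v.adicCompletionIntegers K) (W.localMinimalModel v)
    rw [hΔ', hc₄', ← hj']
    exact hjΔ _
  have key : (W.j : v.adicCompletion K) * ((J.Δ : O) : v.adicCompletion K) =
      ((J.c₄ : O) : v.adicCompletion K) ^ 3 := by
    rw [hJ, variableChange_Δ, variableChange_c₄]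
    push_cast
    rw [mul_pow, ← pow_mul, ← keyM]
    ring
  -- read off `v(j) ≤ exp (d - 3k) ≤ 1`
  have hvJΔ : Valued.v (((J.Δ : O)) : v.adicCompletion K) = WithZero.exp (-(d : ℤ)) := by
    rw [hJ, variableChange_Δ]
    push_cast
    rw [map_mul, map_pow, hvu, one_pow, one_mul, hvΔ]
  have hne : WithZero.exp (-(d : ℤ)) ≠ 0 := WithZero.exp_ne_zero
  have hvj : Valued.v (W.j : v.adicCompletion K) ≤ WithZero.exp ((d : ℤ) - 3 * k) := by
    have h := congrArg Valued.v key
    rw [map_mul, map_pow, hvJΔ] at h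
    calc Valued.v (W.j : v.adicCompletion K)
        = Valued.v (W.j : v.adicCompletion K) * WithZero.exp (-(d : ℤ)) * WithZero.exp (d : ℤ) := by
          rw [mul_assoc, ← WithZero.exp_add, neg_add_cancel, WithZero.exp_zero, mul_one]
      _ = Valued.v ((J.c₄ : O) : v.adicCompletion K) ^ 3 * WithZero.exp (d : ℤ) := by rw [h]
      _ ≤ WithZero.exp (-(k : ℤ)) ^ 3 * WithZero.exp (d : ℤ) := by
          gcongr
          exact zero_le
      _ = WithZero.exp ((d : ℤ) - 3 * k) := by
          rw [← WithZero.exp_nsmul, ← WithZero.exp_add]; congr 1; ring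
  rw [← HeightOneSpectrum.valuedAdicCompletion_eq_valuation']
  refine hvj.trans ?_
  rw [← WithZero.exp_zero, WithZero.exp_le_exp]
  omega

end Local

end WeierstrassCurve

/-! ### The corner of X11b@3: `3 ∤ #ρ̄_{E,3}(Γ_ℚ)`, hence no `IV`/`IV*` away from `2` -/

namespace Summit.BirchSwinnertonDyer.Rank1Residual.X11b.Three

variable (W : WeierstrassCurve ℚ) [W.IsElliptic]

/-- **On the corner `3 ∤ #ρ̄_{E,3}(Γ_ℚ)`**: `E[3]` irreducible (from `ClassX11b`) and `ρ̄_{E,3}`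
not onto ⇒ the image has order prime to `3` (Serre 1972 Prop. 15 with the determinant condition:
a proper irreducible subgroup of `GL₂(𝔽₃)` with full determinant is the normaliser of a Cartan, a
`2`-group at `p = 3`; tree: `not_dvd_card_of_not_hasSurjectiveModNGaloisRep` in a frame
`exists_frame_galoisRepTorsion_rat`). [cite: Serre1972, §2.4 Prop. 15 and §5.4, proof of Prop. 21] -/
theorem not_three_dvd_card_range_galoisRepTorsion_of_not_surj [Fact (Nat.Prime 3)]
    (hX : ClassX11b W 3) (hns : ¬ Surj W 3) :
    ¬ 3 ∣ Nat.card (galoisRepTorsion W (3 : ℕ)).range := by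
  obtain ⟨e, Φ, he, -⟩ := exists_frame_galoisRepTorsion_rat W 3
  rw [← card_map_range_galoisRepTorsion W 3 Φ]
  exact not_dvd_card_of_not_hasSurjectiveModNGaloisRep W 3 Φ e he hX.2.2.2 hns

/-- **S14: on the corner of X11b@3 every place of Kodaira type `IV` or `IV*` lies over `2`**
(granted Serre's inertia order at the potentially good places `v ∣ ℓ ≥ 5` of `E`, hypothesis `hF` —
Serre 1972 §5.6 via Martin–Watkins 2006 §3.2, filed as the named fact
`serre_inertiaOrder_dvd_card_range_galoisRepTorsion`). For such a place `v ∣ ℓ`: `ℓ ≠ 3` (multiplicative at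
`3`, `primesEquiv_ne_three_of_typeIV`); if `ℓ ≠ 2` then `ℓ ≥ 5`, the residue characteristic is
`≠ 2, 3`, `j` is `v`-integral (`valuation_j_le_one_of_kodairaSymbolAt_IV_or_IVstar`) and
`ord_v Δ_min = 4` or `8`, so `hF` gives `12/gcd(12,4) = 12/gcd(12,8) = 3 ∣ #ρ̄_{E,3}(Γ_ℚ)`,
contradicting `not_three_dvd_card_range_galoisRepTorsion_of_not_surj`. CONDITIONAL on `hF`;
nothing booked; the corner has no TRUE-OPEN cell — this only sharpens the ∀-`N` binder list.
[cite: MartinWatkins2006, §3.2] [cite: Serre1972, §5.6 (p. 312) and §2.4 Prop. 15]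
[cite: SilvermanATAEC1994, IV.9.4 Steps 5 and 8, Table 4.1] -/
theorem primesEquiv_eq_two_of_not_surj_of_kodairaSymbolAt_IV_or_IVstar [Fact (Nat.Prime 3)]
    (hF : ∀ v : HeightOneSpectrum (𝓞 ℚ), 5 ≤ (primesEquiv v : ℕ) → v.valuation ℚ W.j ≤ 1 →
      12 / Nat.gcd 12 (W.ordMinimalDiscriminant v) ∣ Nat.card (galoisRepTorsion W (3 : ℕ)).range)
    (hX : ClassX11b W 3) (hns : ¬ Surj W 3) {v : HeightOneSpectrum (𝓞 ℚ)}
    (hk : W.kodairaSymbolAt v = .IV ∨ W.kodairaSymbolAt v = .IVstar) :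
    (primesEquiv v : ℕ) = 2 := by
  by_contra h2
  have hℓ : (primesEquiv v : ℕ).Prime := (primesEquiv v).2
  have h3 : (primesEquiv v : ℕ) ≠ 3 := primesEquiv_ne_three_of_typeIV W hX hk
  have h5 : 5 ≤ (primesEquiv v : ℕ) := by
    by_contra hlt
    have := hℓ.two_le
    interval_cases h : (primesEquiv v : ℕ) <;> first | exact absurd hℓ (by decide) | omega
  have hc := X2.ringChar_quot_asIdeal_eq_primesEquiv v
  have hc2 : ringChar (𝓞 ℚ ⧸ v.asIdeal) ≠ 2 := by rw [hc]; exact h2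
  have hc3 : ringChar (𝓞 ℚ ⧸ v.asIdeal) ≠ 3 := by rw [hc]; exact h3
  haveI : Finite (IsLocalRing.ResidueField (v.adicCompletionIntegers ℚ)) :=
    HeightOneSpectrum.finite_residueField_adicCompletionIntegers ℚ v
  haveI : PerfectField (IsLocalRing.ResidueField (v.adicCompletionIntegers ℚ)) :=
    PerfectField.ofFinite
  have hj : v.valuation ℚ W.j ≤ 1 :=
    W.valuation_j_le_one_of_kodairaSymbolAt_IV_or_IVstar v hc2 hc3 hk
  -- `ord_v Δ_min ∈ {4, 8}`, so Serre's inertia order is `3`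
  have hadd : W.HasAdditiveReductionAt v :=
    (W.isAdditive_kodairaSymbolAt_iff_holds v).mp (isAdditive_of_eq_IV_or_IVstar hk)
  have hord : W.ordMinimalDiscriminant v = W.numComponentsAt v + 1 :=
    W.ordMinimalDiscriminant_eq_numComponentsAt_add_one_holds v hadd hc2 hc3
  have hd : 12 / Nat.gcd 12 (W.ordMinimalDiscriminant v) = 3 := by
    rw [hord]; unfold numComponentsAt
    rcases hk with hk | hk <;> rw [hk] <;> decide
  have hdvd := hF v h5 hj
  rw [hd] at hdvd
  exact not_three_dvd_card_range_galoisRepTorsion_of_not_surj W hX hns hdvd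

/-- **S14, (T2γ) form: on the corner a (T2γ)@3 witness lies over `2`** (granted `hF`): if
`ShapeGamma W` (some place of type `IV`/`IV*` with local Tamagawa number `3`) then that place lies
over `2`. So for `ClassX11b W 3 ∧ ¬ Surj W 3` the additive Tamagawa-`3` carrier is confined to
`ℓ = 2` — class-wide (census: empty there too, 0/140, EVIDENCE only). CONDITIONAL on `hF`;
nothing booked. [cite: MartinWatkins2006, §3.2] [cite: Serre1972, §5.6 (p. 312)] -/
theorem shapeGamma_over_two_of_not_surj [Fact (Nat.Prime 3)]
    (hF : ∀ v : HeightOneSpectrum (𝓞 ℚ), 5 ≤ (primesEquiv v : ℕ) → v.valuation ℚ W.j ≤ 1 →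
      12 / Nat.gcd 12 (W.ordMinimalDiscriminant v) ∣ Nat.card (galoisRepTorsion W (3 : ℕ)).range)
    (hX : ClassX11b W 3) (hns : ¬ Surj W 3) (hγ : ShapeGamma W) :
    ∃ v : HeightOneSpectrum (𝓞 ℚ), (primesEquiv v : ℕ) = 2 ∧
      (W.kodairaSymbolAt v = .IV ∨ W.kodairaSymbolAt v = .IVstar) ∧ W.tamagawaNumberAt v = 3 := by
  obtain ⟨v, hk, hc⟩ := hγ
  exact ⟨v, primesEquiv_eq_two_of_not_surj_of_kodairaSymbolAt_IV_or_IVstar W hF hX hns hk, hk, hc⟩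

/-- **S14, contrapositive for the binder lists of S12/S13: on the corner there is NO place of type
`IV`/`IV*` over any `ℓ ≠ 2`** (granted `hF`). [cite: MartinWatkins2006, §3.2] [cite: Serre1972, §5.6 (p. 312)] -/
theorem not_kodairaSymbolAt_IV_or_IVstar_of_not_surj_of_ne_two [Fact (Nat.Prime 3)]
    (hF : ∀ v : HeightOneSpectrum (𝓞 ℚ), 5 ≤ (primesEquiv v : ℕ) → v.valuation ℚ W.j ≤ 1 →
      12 / Nat.gcd 12 (W.ordMinimalDiscriminant v) ∣ Nat.card (galoisRepTorsion W (3 : ℕ)).range)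
    (hX : ClassX11b W 3) (hns : ¬ Surj W 3) {v : HeightOneSpectrum (𝓞 ℚ)}
    (hv : (primesEquiv v : ℕ) ≠ 2) :
    ¬ (W.kodairaSymbolAt v = .IV ∨ W.kodairaSymbolAt v = .IVstar) := fun hk ↦
  hv (primesEquiv_eq_two_of_not_surj_of_kodairaSymbolAt_IV_or_IVstar W hF hX hns hk)

end Summit.BirchSwinnertonDyer.Rank1Residual.X11b.Three

end
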